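import Summits.Parity.GeneralizedHardyLittlewood.Theses.PrimeLevelFamEdge
import Literature.NumberTheory.LFunctions.Bettin2017LargeShiftPetersson
import HarnessLib

/-!
# Route `PrimeLevelFamEdge`, support `FirstMomentPrinted` (stmt-Parity-20345):
# Bettin's printed first moment rests on Petersson's formula at prime level ALONE

The route support `FirstMomentPrinted := Literature.NumberTheory.LFunctions.bettin2017_theorem11_primeLevel`
(Bettin 2017, Thm. 1.1 at prime level `N`, weight `2`, trivial twist, no shift: the twisted harmonic
first moment `Σʰ_f λ_f(m) L(½,f) = m^{−1/2} + O_ε(m^{1/2} N^{−1+ε})`, all `m ≥ 1`) is the binder `hF`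
of the route's deciding theorem `closes` and the antecedent of the value crux
`BeyondDiagonalBeatsQuarter`.  The cell landau-siegel / ls-inputs (line `hecke_afe_petersson`,
skeleton `Cruxes/FirstMomentPrinted/Lines/hecke_afe_petersson.lean`) has reduced it in the kernel to
ONE printed input: Petersson's trace formula at prime level and weight `2` as typed,
`KowalskiMichel2000.kowalskiMichel2000_peterssonFormula` (Kowalski–Michel 2000, §2.4.2 p. 312 =
Bettin's Lemma 2.2), via the exact two-sided central-value formula, Petersson inside the harmonic
average, the off-diagonal by partial summation and Weil's bound, the dual piece, and the large-shift
regime WITHOUT the Ramanujan–Petersson bound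
(`Literature.NumberTheory.LFunctions.Bettin2017.bettin2017_theorem11_primeLevel_of_petersson`,
`Bettin2017LargeShiftPetersson.lean`).

* `firstMomentPrinted_of_peterssonFormula : kowalskiMichel2000_peterssonFormula → FirstMomentPrinted`;
* `firstMomentPrinted_and_peterssonBoundPrinted_of_peterssonFormula` — BOTH Petersson-family printed
  slots of `closes` (`hF : FirstMomentPrinted`, `hP : PeterssonBoundPrinted`) follow from that one
  printed identity (the second as in the companion file `PrimeLevelFamEdgePeterssonBoundOfFormula.lean`:
  Kowalski–Michel (23) from the formula, Weil's bound being the tree's theorem —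
  `KowalskiMichel2000.peterssonBound_of_peterssonFormula'`).

CONDITIONAL results by design (the antecedent is an unproved printed identity, input I1 of the cell;
nothing here claims the item outright — it closes by the one-liner
`firstMomentPrinted_of_peterssonFormula kowalskiMichel2000_peterssonFormula_holds` once I1 lands).
«The programme SEARCHES and TYPES; no claim about Landau–Siegel zeros, Theorems 1–2 of
arXiv:2211.02515 or a repaired Margin232 until a kernel theorem says so.»
-/

namespace Summit.Parity.GeneralizedHardyLittlewood.Theorems

/-- **Support `FirstMomentPrinted` (stmt-Parity-20345) from Petersson's formula alone.**  Bettin 2017,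
Thm. 1.1 at prime level as typed (`bettin2017_theorem11_primeLevel`, all shifts `m ≥ 1`) follows from
the printed identity `kowalskiMichel2000_peterssonFormula` (Kowalski–Michel 2000, p. 312; input I1)
by the tree's kernel theorem `Bettin2017.bettin2017_theorem11_primeLevel_of_petersson` (small shifts
`m ≤ N^{24}`: `firstMoment_sub_le_of_petersson`; large shifts: `largeShift_of_petersson`, Weil's bound
and `|J₁(x)| ≤ min(1, x/2)`, no Deligne). -/
theorem firstMomentPrinted_of_peterssonFormula
    (hP : Literature.NumberTheory.LFunctions.KowalskiMichel2000.kowalskiMichel2000_peterssonFormula) :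
    Theses.PrimeLevelFamEdge.FirstMomentPrinted := by
  unfold Theses.PrimeLevelFamEdge.FirstMomentPrinted
  exact Literature.NumberTheory.LFunctions.Bettin2017.bettin2017_theorem11_primeLevel_of_petersson hP

/-- **Both Petersson-family printed slots of the route's deciding theorem rest on ONE printed fact.**
Given Petersson's formula at prime level (`kowalskiMichel2000_peterssonFormula`, input I1), both
`FirstMomentPrinted` (binder `hF` of `closes`; Bettin 2017 Thm. 1.1) and `PeterssonBoundPrinted`
(binder `hP`; Kowalski–Michel (23) in its range, from the formula and the tree's Weil bound,
`KowalskiMichel2000.peterssonBound_of_peterssonFormula'`) hold. -/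
theorem firstMomentPrinted_and_peterssonBoundPrinted_of_peterssonFormula
    (hP : Literature.NumberTheory.LFunctions.KowalskiMichel2000.kowalskiMichel2000_peterssonFormula) :
    Theses.PrimeLevelFamEdge.FirstMomentPrinted ∧ Theses.PrimeLevelFamEdge.PeterssonBoundPrinted := by
  refine ⟨firstMomentPrinted_of_peterssonFormula hP, ?_⟩
  unfold Theses.PrimeLevelFamEdge.PeterssonBoundPrinted
  exact Literature.NumberTheory.LFunctions.KowalskiMichel2000.peterssonBound_of_peterssonFormula' hP

end Summit.Parity.GeneralizedHardyLittlewood.Theorems
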